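import Summits.QuantumAdvantage.AdviceFreeQNC0.PairSpeedFibre
import HarnessLib

/-!
# Cell qa-qnc0 (odd primes), rung R7 — the named phase `E` is a low-degree NAMING FUNCTION

Continuation of `PairSpeedFibre.lean` (planner qa-qnc0-p2 g15, ROUND-15 §3.4 step (iv)): the named phase
`PairSpeed.E c y w v ∈ {0,1,2}` depends on the rest variable `v` only through
* the `≤ 3(2w+3)` NEAR OUTPUTS `y_g(emb t v)` (`g` within distance `w` of the pair, `t` a speed), each of
  `𝔽_p`-degree `≤ D` in `v` (restriction of a degree-`D` cut to the pair fibre: the coordinates of `emb t v`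
  are variables, complemented variables or constants), and
* the `≤ 2w` LOCAL REST BITS next to the pair (degree `1`),
so each level set `[E = r]` has `𝔽_p`-degree `≤ (8w + 9)·D` (`levelSet_mem`, by the pattern-degree lemma
`GapFibre.ind_mem_lowDeg_of_pattern`), for every prime `p`.

WHAT THIS IS NOT: no statement about the game beyond R7's hypothesis; separation NOT moved.
-/

noncomputable section

namespace Summit.QuantumAdvantage.AdviceFreeQNC0

open Classical
open Finset
open Literature.Computability.MetaComplexity Literature.Computability.MetaComplexity.Smolensky

namespace PairSpeed

variable {a q : ℕ} (c : ℕ) (y : Fin (a + 2 + q + 1) → (Fin (a + 2 + q) → Bool) → Bool)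

/-! ### Determinedness -/

/-- `M(·, qq)` is determined by the near outputs and the local rest bits. -/
theorem M_congr {w : ℕ} {v v' : Fin (a + q) → Bool}
    (hloc : ∀ i : Fin (a + q), a ≤ i.val + w → i.val < a + w → v i = v' i)
    (hout : ∀ g ∈ near (a := a) (q := q) w, ∀ t : Fin 3, y g (emb t v) = y g (emb t v')) (qq : ℕ) :
    M c y w v qq = M c y w v' qq := by
  unfold M
  refine Finset.sum_congr rfl fun g hg => congrArg _ (Finset.filter_congr fun t _ => ?_)
  have hg' := (mem_filter.1 hg).2
  rw [hout g hg t, Nat.add_mod, Om_mod_congr c hg' t hloc, ← Nat.add_mod]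

/-- Hence so is the named phase `E`. -/
theorem E_congr {w : ℕ} {v v' : Fin (a + q) → Bool}
    (hloc : ∀ i : Fin (a + q), a ≤ i.val + w → i.val < a + w → v i = v' i)
    (hout : ∀ g ∈ near (a := a) (q := q) w, ∀ t : Fin 3, y g (emb t v) = y g (emb t v')) :
    E c y w v = E c y w v' := by
  unfold E
  rw [M_congr c y hloc hout 0, M_congr c y hloc hout 1]

/-! ### The features and their degrees -/

/-- The features: near outputs `(g, t) ↦ y_g(emb t v)` and rest bits `i ↦ v_i`. -/
def feat : (Fin (a + 2 + q + 1) × Fin 3) ⊕ Fin (a + q) → (Fin (a + q) → Bool) → Bool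
  | Sum.inl gt => fun v => y gt.1 (emb gt.2 v)
  | Sum.inr i => fun v => v i

/-- The local rest bits: positions within distance `w` of the pair (in rest coordinates). -/
def loc (w : ℕ) : Finset (Fin (a + q)) := univ.filter fun i => a ≤ i.val + w ∧ i.val < a + w

/-- The relevant feature indices: near cuts × speeds, and local rest bits. -/
def featSet (w : ℕ) : Finset ((Fin (a + 2 + q + 1) × Fin 3) ⊕ Fin (a + q)) :=
  (near (a := a) (q := q) w ×ˢ (univ : Finset (Fin 3))).disjSum (loc w)

/-- There are at most `2w + 3` near cuts. -/
theorem card_near_le (w : ℕ) : (near (a := a) (q := q) w).card ≤ 2 * w + 3 := by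
  have h : (near (a := a) (q := q) w).card ≤ (Finset.Icc (a - w) (a + 2 + w)).card :=
    Finset.card_le_card_of_injOn (fun g => g.val)
      (fun g hg => by
        have h := (mem_filter.1 (Finset.mem_coe.1 hg)).2
        simp only [Finset.coe_Icc, Set.mem_Icc]; omega)
      (fun g _ g' _ h => Fin.ext h)
  rw [Nat.card_Icc] at h
  omega

/-- There are at most `2w` local rest bits. -/
theorem card_loc_le (w : ℕ) : (loc (a := a) (q := q) w).card ≤ 2 * w := by
  have h : (loc (a := a) (q := q) w).card ≤ (Finset.Ico (a - w) (a + w)).card :=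
    Finset.card_le_card_of_injOn (fun i => i.val)
      (fun i hi => by
        have h := (mem_filter.1 (Finset.mem_coe.1 hi)).2
        simp only [Finset.coe_Ico, Set.mem_Ico]; omega)
      (fun i _ i' _ h => Fin.ext h)
  rw [Nat.card_Ico] at h
  omega

/-- At most `8w + 9` features. -/
theorem card_featSet_le (w : ℕ) : (featSet (a := a) (q := q) w).card ≤ 8 * w + 9 := by
  unfold featSet
  rw [Finset.card_disjSum, Finset.card_product, Finset.card_univ, Fintype.card_fin]
  have h1 := card_near_le (a := a) (q := q) w
  have h2 := card_loc_le (a := a) (q := q) w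
  nlinarith

variable {p : ℕ} [Fact p.Prime]

/-- Every coordinate of `emb t v` is a variable, a complemented variable or a constant: degree `≤ 1` in `v`. -/
theorem emb_coord_mem (t : Fin 3) (i : Fin (a + 2 + q)) :
    (fun v : Fin (a + q) → Bool => if emb t v i = true then (1 : ZMod p) else 0) ∈ lowDeg (ZMod p) (a + q) 1 := by
  by_cases h1 : i.val < a
  · have e : (fun v : Fin (a + q) → Bool => if emb t v i = true then (1 : ZMod p) else 0) =
        fun v => if v ⟨i.val, by omega⟩ then (1 : ZMod p) else 0 := by
      funext v; rw [emb_apply_lt t v i h1]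
    rw [e]; exact bitFn_mem_lowDeg _ le_rfl
  · by_cases h2 : a + 2 ≤ i.val
    · have e : (fun v : Fin (a + q) → Bool => if emb t v i = true then (1 : ZMod p) else 0) =
          1 - fun v => if v ⟨i.val - 2, by omega⟩ then (1 : ZMod p) else 0 := by
        funext v
        rw [emb_apply_ge t v i h2]
        simp only [Pi.sub_apply, Pi.one_apply]
        cases v ⟨i.val - 2, by omega⟩ <;> simp
      rw [e]; exact Submodule.sub_mem _ (one_mem_lowDeg 1) (bitFn_mem_lowDeg _ le_rfl)
    · -- a pair position: constant
      have e : (fun v : Fin (a + q) → Bool => if emb t v i = true then (1 : ZMod p) else 0) =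
          fun _ => if zvec t ⟨i.val - a, by omega⟩ = true then (1 : ZMod p) else 0 := by
        funext v
        unfold emb; rw [glue3_apply_mid _ _ _ i (by omega) (by omega)]
      rw [e]
      by_cases hz : zvec t ⟨i.val - a, by omega⟩ = true
      · simp only [hz, if_true]; exact one_mem_lowDeg 1
      · simp only [hz]; exact Submodule.zero_mem _

/-- Each relevant feature has degree `≤ D` (`D ≥ 1`). -/
theorem feat_mem {D : ℕ} (hD : 1 ≤ D) (hdeg : ∀ g, HasDegF p (y g) D) (w : ℕ) :
    ∀ f ∈ featSet (a := a) (q := q) w,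
      (fun v => if feat y f v = true then (1 : ZMod p) else 0) ∈ lowDeg (ZMod p) (a + q) D := by
  rintro (⟨g, t⟩ | i) _
  · have h := comp_mem_lowDeg_of_coord (F := ZMod p) (emb (a := a) (q := q) t) (emb_coord_mem t) (hdeg g)
    exact h
  · exact bitFn_mem_lowDeg _ hD

/-- **The level sets of the named phase have degree `≤ (8w+9)·D`** (any prime `p`). -/
theorem levelSet_mem {D : ℕ} (hD : 1 ≤ D) (hdeg : ∀ g, HasDegF p (y g) D) (w r : ℕ) :
    (fun v => if E c y w v = r then (1 : ZMod p) else 0) ∈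
      lowDeg (ZMod p) (a + q) ((featSet (a := a) (q := q) w).card * D) := by
  have h := GapFibre.ind_mem_lowDeg_of_pattern (F := ZMod p) (featSet (a := a) (q := q) w) (feat y)
    (feat_mem y hD hdeg w) (fun v => decide (E c y w v = r)) (fun v v' hvv' => by
      have hloc : ∀ i : Fin (a + q), a ≤ i.val + w → i.val < a + w → v i = v' i := fun i h1 h2 =>
        hvv' (Sum.inr i) (by
          unfold featSet loc
          rw [Finset.inr_mem_disjSum, mem_filter]
          exact ⟨mem_univ _, h1, h2⟩)
      have hout : ∀ g ∈ near (a := a) (q := q) w, ∀ t : Fin 3, y g (emb t v) = y g (emb t v') :=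
        fun g hg t => hvv' (Sum.inl (g, t)) (by
          unfold featSet
          rw [Finset.inl_mem_disjSum, Finset.mem_product]
          exact ⟨hg, mem_univ _⟩)
      rw [E_congr c y hloc hout])
  refine (congrArg (· ∈ lowDeg (ZMod p) (a + q) ((featSet (a := a) (q := q) w).card * D)) ?_).mpr h
  funext v
  simp only [decide_eq_true_eq]

end PairSpeed

end Summit.QuantumAdvantage.AdviceFreeQNC0

end
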